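import Mathlib

/-!
# Reduction modulo an inert prime for CUBIC units: `rank U(θ) = |𝒜|` over `𝔽_{p³}` certifies a cubic unit class (LEMMA R_p, cubic case)

Helper file for crux `stmt-CriticalPhenomena-4575` (`NoHeavyLowerTail`, route `PercNearOneGluingNoHeavy`), new-inequality factory
seat `prim-ineq-gen-3` (gen 28).  Everything here is PROVED; no definitions.  Cubic companion of `…OrderedDifferencesQuadraticReduction` /
`…QuadraticCertificates`: the relation is `t³ = u t² + v t + w`, elements of `ℤ[t]` are `a + b t + e t²`.

* `cubic_mul_expand` — `(a + bt + et²)(z + t y) = (a z + w e y) + (b z + a y + v e y) t + (e z + b y + u e y) t²`.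
* `exists_reduced_dependency_of_integral_dependency_cubic` — ★ an integral dependency `A ↦ a_A + b_A t + e_A t²` of the pencil at `t`
  (in a field `K` where `1, t, t²` are `ℤ`-independent) yields a non-zero dependency at `θ` (in a field `F` where `a + bθ + eθ² = 0` forces
  `p ∣ a, b, e`) [three integer identities per column; `p`-adic descent on `∑ |a| + |b| + |e|`; reduction].
* `exists_int3_of_mem_adjoin_cubic` — `ℤ[t] = ℤ + ℤ t + ℤ t²`.
* `linearIndependent_pencil_cubic_of_reduction` — ★★ LEMMA R_p, cubic case.
The side hypotheses are discharged from finite checks (no root mod `p`, no integer root) in `…OrderedDifferencesCubicCertificates`,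
with the instances heptagonal / plastic / conductor 9 over `𝔽₈`.  (prim-ineq-gen-3 gen 28, 2026-08-25.)
-/

namespace Summit.CriticalPhenomena.PercolationContinuityZ3.Theorems

namespace OrderedDifferences

open Finset
open scoped FinsetFamily

variable {α : Type*} [DecidableEq α]

/-- `(a + bt + et²)(z + t y) = (a z + w e y) + (b z + a y + v e y) t + (e z + b y + u e y) t²` when `t³ = u t² + v t + w`. -/
theorem cubic_mul_expand {R : Type*} [CommRing R] {t u v w : R} (ht : t * t * t = u * t * t + v * t + w) (a b e z y : R) :
    (a + b * t + e * t * t) * (z + t * y) =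
      (a * z + w * (e * y)) + (b * z + a * y + v * (e * y)) * t + (e * z + b * y + u * (e * y)) * t * t := by
  linear_combination (e * y) * ht

/-- **Integral dependency at `t` ⟹ dependency at the reduction `θ` (cubic).** -/
theorem exists_reduced_dependency_of_integral_dependency_cubic (𝒜 : Finset (Finset α)) (u v w : ℤ) {p : ℕ} (hp : 1 < p)
    {K : Type*} [Field K] {t : K} (ht : t * t * t = (u : K) * t * t + (v : K) * t + (w : K))
    (hK : ∀ a b e : ℤ, (a : K) + (b : K) * t + (e : K) * t * t = 0 → a = 0 ∧ b = 0 ∧ e = 0)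
    {F : Type*} [Field F] {θ : F} (hθ : θ * θ * θ = (u : F) * θ * θ + (v : F) * θ + (w : F))
    (hF : ∀ a b e : ℤ, (a : F) + (b : F) * θ + (e : F) * θ * θ = 0 → (p : ℤ) ∣ a ∧ (p : ℤ) ∣ b ∧ (p : ℤ) ∣ e)
    (a b e : ↥𝒜 → ℤ) (habe : ∃ A, a A ≠ 0 ∨ b A ≠ 0 ∨ e A ≠ 0)
    (hdep : ∀ E ∈ 𝒜 \\ 𝒜, ∑ A : 𝒜, ((a A : K) + (b A : K) * t + (e A : K) * t * t) *
        ((if E ⊆ (A : Finset α) then (1 : K) else 0) + t * (if Disjoint E (A : Finset α) then (1 : K) else 0)) = 0) :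
    ∃ c : ↥𝒜 → F, c ≠ 0 ∧ ∀ E ∈ 𝒜 \\ 𝒜, ∑ A : 𝒜, c A *
        ((if E ⊆ (A : Finset α) then (1 : F) else 0) + θ * (if Disjoint E (A : Finset α) then (1 : F) else 0)) = 0 := by
  classical
  let zI : ↥𝒜 → Finset α → ℤ := fun A E => if E ⊆ (A : Finset α) then 1 else 0
  let yI : ↥𝒜 → Finset α → ℤ := fun A E => if Disjoint E (A : Finset α) then 1 else 0
  -- the three integer identities per column (as a predicate on integer triples of vectors)
  let P0 : (↥𝒜 → ℤ) → (↥𝒜 → ℤ) → (↥𝒜 → ℤ) → Finset α → ℤ :=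
    fun a b e E => ∑ A : 𝒜, (a A * zI A E + w * (e A * yI A E))
  let P1 : (↥𝒜 → ℤ) → (↥𝒜 → ℤ) → (↥𝒜 → ℤ) → Finset α → ℤ :=
    fun a b e E => ∑ A : 𝒜, (b A * zI A E + a A * yI A E + v * (e A * yI A E))
  let P2 : (↥𝒜 → ℤ) → (↥𝒜 → ℤ) → (↥𝒜 → ℤ) → Finset α → ℤ :=
    fun a b e E => ∑ A : 𝒜, (e A * zI A E + b A * yI A E + u * (e A * yI A E))
  have hP : ∀ E ∈ 𝒜 \\ 𝒜, P0 a b e E = 0 ∧ P1 a b e E = 0 ∧ P2 a b e E = 0 := by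
    intro E hE
    have h := hdep E hE
    have ex : ∑ A : 𝒜, ((a A : K) + (b A : K) * t + (e A : K) * t * t) *
        ((if E ⊆ (A : Finset α) then (1 : K) else 0) + t * (if Disjoint E (A : Finset α) then (1 : K) else 0)) =
        ((P0 a b e E : ℤ) : K) + ((P1 a b e E : ℤ) : K) * t + ((P2 a b e E : ℤ) : K) * t * t := by
      push_cast [P0, P1, P2, zI, yI]
      rw [sum_mul, sum_mul, sum_mul, ← sum_add_distrib, ← sum_add_distrib]
      refine sum_congr rfl fun A _ => ?_
      rw [cubic_mul_expand ht]
    rw [ex] at h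
    exact hK _ _ _ h
  -- descent on the integer data
  suffices H : ∀ (n : ℕ) (a b e : ↥𝒜 → ℤ), ∑ A : 𝒜, ((a A).natAbs + (b A).natAbs + (e A).natAbs) ≤ n →
      (∃ A, a A ≠ 0 ∨ b A ≠ 0 ∨ e A ≠ 0) → (∀ E ∈ 𝒜 \\ 𝒜, P0 a b e E = 0 ∧ P1 a b e E = 0 ∧ P2 a b e E = 0) →
      ∃ c : ↥𝒜 → F, c ≠ 0 ∧ ∀ E ∈ 𝒜 \\ 𝒜, ∑ A : 𝒜, c A *
        ((if E ⊆ (A : Finset α) then (1 : F) else 0) + θ * (if Disjoint E (A : Finset α) then (1 : F) else 0)) = 0 from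
    H _ a b e le_rfl habe hP
  intro n
  induction n with
  | zero =>
    intro a b e hle habe _
    obtain ⟨A, hA⟩ := habe
    have h0 : (a A).natAbs + (b A).natAbs + (e A).natAbs ≤ 0 :=
      le_trans (single_le_sum (f := fun A : ↥𝒜 => (a A).natAbs + (b A).natAbs + (e A).natAbs)
        (fun _ _ => Nat.zero_le _) (mem_univ A)) hle
    omega
  | succ n ih =>
    intro a b e hle habe hz
    by_cases hndvd : ∃ A, ¬ ((p : ℤ) ∣ a A) ∨ ¬ ((p : ℤ) ∣ b A) ∨ ¬ ((p : ℤ) ∣ e A)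
    · -- reduce modulo p
      obtain ⟨A0, hA0⟩ := hndvd
      refine ⟨fun A => (a A : F) + (b A : F) * θ + (e A : F) * θ * θ, ?_, ?_⟩
      · intro hc
        have h0 := congr_fun hc A0
        simp only [Pi.zero_apply] at h0
        obtain ⟨h1, h2, h3⟩ := hF _ _ _ h0
        rcases hA0 with h | h | h
        · exact h h1
        · exact h h2
        · exact h h3
      · intro E hE
        obtain ⟨h1, h2, h3⟩ := hz E hE
        have ex : ∑ A : 𝒜, ((a A : F) + (b A : F) * θ + (e A : F) * θ * θ) *
            ((if E ⊆ (A : Finset α) then (1 : F) else 0) + θ * (if Disjoint E (A : Finset α) then (1 : F) else 0)) =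
            ((P0 a b e E : ℤ) : F) + ((P1 a b e E : ℤ) : F) * θ + ((P2 a b e E : ℤ) : F) * θ * θ := by
          push_cast [P0, P1, P2, zI, yI]
          rw [sum_mul, sum_mul, sum_mul, ← sum_add_distrib, ← sum_add_distrib]
          refine sum_congr rfl fun A _ => ?_
          rw [cubic_mul_expand hθ]
        rw [ex, h1, h2, h3]
        push_cast
        ring
    · -- all coordinates divisible by p: divide and recurse
      push Not at hndvd
      have hp0 : (p : ℤ) ≠ 0 := by exact_mod_cast (by omega : p ≠ 0)
      let a' : ↥𝒜 → ℤ := fun A => a A / p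
      let b' : ↥𝒜 → ℤ := fun A => b A / p
      let e' : ↥𝒜 → ℤ := fun A => e A / p
      have ha' : ∀ A, a A = p * a' A := fun A => (Int.mul_ediv_cancel' (hndvd A).1).symm
      have hb' : ∀ A, b A = p * b' A := fun A => (Int.mul_ediv_cancel' (hndvd A).2.1).symm
      have he' : ∀ A, e A = p * e' A := fun A => (Int.mul_ediv_cancel' (hndvd A).2.2).symm
      obtain ⟨A0, hA0⟩ := habe
      have hA0' : a' A0 ≠ 0 ∨ b' A0 ≠ 0 ∨ e' A0 ≠ 0 := by
        rcases hA0 with h | h | h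
        · left; intro h'; apply h; rw [ha' A0, h']; ring
        · right; left; intro h'; apply h; rw [hb' A0, h']; ring
        · right; right; intro h'; apply h; rw [he' A0, h']; ring
      have habe' : ∃ A, a' A ≠ 0 ∨ b' A ≠ 0 ∨ e' A ≠ 0 := ⟨A0, hA0'⟩
      have hnat : ∀ x : ℤ, (p * x).natAbs = p * x.natAbs := fun x => by
        rw [Int.natAbs_mul]; simp
      have hle' : ∑ A : 𝒜, ((a' A).natAbs + (b' A).natAbs + (e' A).natAbs) ≤ n := by
        have hlt : ∑ A : 𝒜, ((a' A).natAbs + (b' A).natAbs + (e' A).natAbs) <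
            ∑ A : 𝒜, ((a A).natAbs + (b A).natAbs + (e A).natAbs) := by
          apply sum_lt_sum
          · intro A _
            rw [ha' A, hb' A, he' A, hnat, hnat, hnat]
            nlinarith [Nat.zero_le (a' A).natAbs, Nat.zero_le (b' A).natAbs, Nat.zero_le (e' A).natAbs]
          · refine ⟨A0, mem_univ _, ?_⟩
            rw [ha' A0, hb' A0, he' A0, hnat, hnat, hnat]
            have hsum : 0 < (a' A0).natAbs + (b' A0).natAbs + (e' A0).natAbs := by
              rcases hA0' with h | h | h
              · have := Int.natAbs_pos.mpr h; omega
              · have := Int.natAbs_pos.mpr h; omega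
              · have := Int.natAbs_pos.mpr h; omega
            nlinarith
        omega
      have hz' : ∀ E ∈ 𝒜 \\ 𝒜, P0 a' b' e' E = 0 ∧ P1 a' b' e' E = 0 ∧ P2 a' b' e' E = 0 := by
        intro E hE
        obtain ⟨h1, h2, h3⟩ := hz E hE
        have e1 : P0 a b e E = p * P0 a' b' e' E := by
          simp only [P0]; rw [mul_sum]; refine sum_congr rfl fun A _ => ?_; rw [ha' A, he' A]; ring
        have e2 : P1 a b e E = p * P1 a' b' e' E := by
          simp only [P1]; rw [mul_sum]; refine sum_congr rfl fun A _ => ?_; rw [ha' A, hb' A, he' A]; ring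
        have e3 : P2 a b e E = p * P2 a' b' e' E := by
          simp only [P2]; rw [mul_sum]; refine sum_congr rfl fun A _ => ?_; rw [hb' A, he' A]; ring
        rw [e1] at h1; rw [e2] at h2; rw [e3] at h3
        exact ⟨(mul_eq_zero.mp h1).resolve_left hp0, (mul_eq_zero.mp h2).resolve_left hp0, (mul_eq_zero.mp h3).resolve_left hp0⟩
      exact ih a' b' e' hle' habe' hz'

/-- Every element of `ℤ[t] = Algebra.adjoin ℤ {t}` is `a + b t + e t²` when `t³ = u t² + v t + w` (`u v w : ℤ`). -/
theorem exists_int3_of_mem_adjoin_cubic {K : Type*} [Field K] {t : K} (u v w : ℤ)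
    (ht : t * t * t = (u : K) * t * t + (v : K) * t + (w : K))
    {x : K} (hx : x ∈ Algebra.adjoin ℤ ({t} : Set K)) : ∃ a b e : ℤ, x = (a : K) + (b : K) * t + (e : K) * t * t := by
  refine Algebra.adjoin_induction (p := fun x _ => ∃ a b e : ℤ, x = (a : K) + (b : K) * t + (e : K) * t * t) ?_ ?_ ?_ ?_ hx
  · intro x hx
    rw [Set.mem_singleton_iff] at hx
    subst hx
    exact ⟨0, 1, 0, by push_cast; ring⟩
  · intro r
    exact ⟨r, 0, 0, by simp⟩
  · rintro x y - - ⟨a, b, e, rfl⟩ ⟨a', b', e', rfl⟩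
    exact ⟨a + a', b + b', e + e', by push_cast; ring⟩
  · rintro x y - - ⟨a, b, e, rfl⟩ ⟨a', b', e', rfl⟩
    refine ⟨a * a' + w * (b * e' + e * b') + u * w * (e * e'),
      a * b' + b * a' + v * (b * e' + e * b') + (u * v + w) * (e * e'),
      a * e' + b * b' + e * a' + u * (b * e' + e * b') + (u * u + v) * (e * e'), ?_⟩
    push_cast
    linear_combination (((b : K) * e' + e * b') + (e : K) * e' * (t + u)) * ht

/-- **LEMMA R_p for cubic units.**  Let `t³ = u t² + v t + w` in a field `K` in which `1, t, t²` are independent over `ℤ`, and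
`θ³ = u θ² + v θ + w` in a field `F` in which `a + bθ + eθ² = 0` (`a b e : ℤ`) forces `p ∣ a, b, e` (`p ≥ 2`).  If the pencil rows of `𝒜`
at `θ` are linearly independent over `F`, then the pencil rows of `𝒜` at `t` are linearly independent over `K`. -/
theorem linearIndependent_pencil_cubic_of_reduction (𝒜 : Finset (Finset α)) (u v w : ℤ) {p : ℕ} (hp : 1 < p)
    {F : Type*} [Field F] {θ : F} (hθ : θ * θ * θ = (u : F) * θ * θ + (v : F) * θ + (w : F))
    (hFp : ∀ a b e : ℤ, (a : F) + (b : F) * θ + (e : F) * θ * θ = 0 → (p : ℤ) ∣ a ∧ (p : ℤ) ∣ b ∧ (p : ℤ) ∣ e)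
    (hF : LinearIndependent F (fun A : 𝒜 => fun E : (𝒜 \\ 𝒜 : Finset (Finset α)) =>
      (if (E : Finset α) ⊆ (A : Finset α) then (1 : F) else 0) +
        θ * (if Disjoint (E : Finset α) (A : Finset α) then (1 : F) else 0)))
    {K : Type*} [Field K] {t : K} (ht : t * t * t = (u : K) * t * t + (v : K) * t + (w : K))
    (hK : ∀ a b e : ℤ, (a : K) + (b : K) * t + (e : K) * t * t = 0 → a = 0 ∧ b = 0 ∧ e = 0) :
    LinearIndependent K (fun A : 𝒜 => fun E : (𝒜 \\ 𝒜 : Finset (Finset α)) =>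
      (if (E : Finset α) ⊆ (A : Finset α) then (1 : K) else 0) +
        t * (if Disjoint (E : Finset α) (A : Finset α) then (1 : K) else 0)) := by
  classical
  set R : Subalgebra ℤ K := Algebra.adjoin ℤ ({t} : Set K) with hR
  have htR : t ∈ R := Algebra.subset_adjoin (Set.mem_singleton t)
  let vR : ↥𝒜 → (𝒜 \\ 𝒜 : Finset (Finset α)) → R := fun A E =>
    ⟨(if (E : Finset α) ⊆ (A : Finset α) then (1 : K) else 0) +
        t * (if Disjoint (E : Finset α) (A : Finset α) then (1 : K) else 0),
      R.add_mem (by split_ifs <;> simp [R.one_mem, R.zero_mem]) (R.mul_mem htR (by split_ifs <;> simp [R.one_mem, R.zero_mem]))⟩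
  have hv : (fun A : ↥𝒜 => algebraMap R K ∘ vR A) = (fun A : 𝒜 => fun E : (𝒜 \\ 𝒜 : Finset (Finset α)) =>
      (if (E : Finset α) ⊆ (A : Finset α) then (1 : K) else 0) +
        t * (if Disjoint (E : Finset α) (A : Finset α) then (1 : K) else 0)) := by
    funext A E
    rfl
  rw [← hv, linearIndependent_algebraMap_comp_iff]
  by_contra hdepR
  obtain ⟨g, hg, A0, hA0⟩ := Fintype.not_linearIndependent_iff.mp hdepR
  have hcoef : ∀ A : ↥𝒜, ∃ abe : ℤ × ℤ × ℤ, ((g A : R) : K) = (abe.1 : K) + (abe.2.1 : K) * t + (abe.2.2 : K) * t * t := by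
    intro A
    obtain ⟨a, b, e, h⟩ := exists_int3_of_mem_adjoin_cubic u v w ht (g A).2
    exact ⟨(a, b, e), h⟩
  choose abe habe using hcoef
  have hne : ∃ A, (abe A).1 ≠ 0 ∨ (abe A).2.1 ≠ 0 ∨ (abe A).2.2 ≠ 0 := by
    refine ⟨A0, ?_⟩
    by_contra h
    push Not at h
    apply hA0
    have ex : ((g A0 : R) : K) = 0 := by rw [habe A0, h.1, h.2.1, h.2.2]; simp
    exact Subtype.ext ex
  have hdep : ∀ E ∈ 𝒜 \\ 𝒜, ∑ A : 𝒜, (((abe A).1 : K) + ((abe A).2.1 : K) * t + ((abe A).2.2 : K) * t * t) *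
      ((if E ⊆ (A : Finset α) then (1 : K) else 0) + t * (if Disjoint E (A : Finset α) then (1 : K) else 0)) = 0 := by
    intro E hE
    have h := congr_fun hg ⟨E, hE⟩
    simp only [Finset.sum_apply, Pi.smul_apply, smul_eq_mul, Pi.zero_apply] at h
    have h' : (((∑ i : ↥𝒜, g i * vR i ⟨E, hE⟩ : R)) : K) = 0 := by rw [h]; rfl
    have ex : ∑ A : 𝒜, (((abe A).1 : K) + ((abe A).2.1 : K) * t + ((abe A).2.2 : K) * t * t) *
        ((if E ⊆ (A : Finset α) then (1 : K) else 0) + t * (if Disjoint E (A : Finset α) then (1 : K) else 0)) =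
        (((∑ i : ↥𝒜, g i * vR i ⟨E, hE⟩ : R)) : K) := by
      push_cast
      refine sum_congr rfl fun A _ => ?_
      rw [habe A]
    rw [ex, h']
  obtain ⟨c, hc0, hc⟩ := exists_reduced_dependency_of_integral_dependency_cubic 𝒜 u v w hp ht hK hθ hFp
    (fun A => (abe A).1) (fun A => (abe A).2.1) (fun A => (abe A).2.2) hne hdep
  rw [Fintype.linearIndependent_iff] at hF
  apply hc0
  funext A
  refine hF c ?_ A
  funext E
  simp only [Finset.sum_apply, Pi.smul_apply, smul_eq_mul, Pi.zero_apply]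
  exact hc E E.2

end OrderedDifferences

end Summit.CriticalPhenomena.PercolationContinuityZ3.Theorems
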